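import Summits.BirchSwinnertonDyer.BirchSwinnertonDyer.Theorems.KolyvaginDepthDoorKolyvaginDepthSupplyCalibration
import Summits.BirchSwinnertonDyer.BirchSwinnertonDyer.Theorems.KolyvaginDepthDoorKolyvaginDepthSupplyAdmissibleData
import Literature.NumberTheory.EllipticCurves.KatoRankBound
import HarnessLib

/-!
# Route `KolyvaginDepthDoor`, crux `KolyvaginDepthSupply` (stmt-BirchSwinnertonDyer-21765) —
# agreement of the doors: λ-door row ⇒ depth row (modulo Kato + BCGS + Kolyvagin), and the crux
# versus KatoTransfer's X1 under the cross-prime transfer of the sibling line `ShaPrimaryTransfer`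

Helper file (`--supports stmt-BirchSwinnertonDyer-21765 --as helper`); closes nothing; BSD is not
proved by it.

* `exists_kolyvaginClass_prime_ne_zero_of_order_padicLFunction_le_two` — **the route's INSTRUMENT
  ROW "depth vs λ-door agreement", one direction made a theorem.** For a rank-2 `E/ℚ` at `p ≥ 5`
  good ordinary with `ρ̄_{E,p}` onto and newform `f`: a λ-door row `ord_{T=0} L_p(E, T) ≤ 2`
  (Stein–Wuthrich 2013: `μ = 0`, `λ = rank`) gives, by Kato's bound
  `corank Sel_{p^∞}(E/ℚ) ≤ ord_T L_p` (`kato_selmerCorank_le_order_padicLFunction`, Kato 2004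
  Thm. 18.4, a named fact) and Kummer, `t_p(E) = 0`; and then, for every admissible Heegner field
  `K` with `c'_p ≤ 1`, BCGS 2026 + Kolyvagin 1991 FORCE a depth row: some first derived class
  `c_M(ℓ) ≠ 0`. So modulo {Kato, BCGS, Kolyvagin} a λ-certified rank-2 pair `(E, p)` cannot have an
  all-zero depth table over any admissible `K` (all `ℓ`, all `M`) — the agreement the route header
  lists as falsifiable is a one-way implication in print. (The converse, depth row ⇒ λ-row, would
  need the main conjecture and Schneider's non-degeneracy; not claimed.)
* `kolyvaginDepthSupply_iff_shaCorankZero_nonCM_of_transfer` — under the sibling line's crux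
  `FiniteShaComponentTransfer` (stmt-BirchSwinnertonDyer-22356: `t_p(E) = 0 ⇒ t_q(E) = 0` for all
  primes; written literally, no import of that route) and the seven facts of
  `kolyvaginDepthSupply_iff_shaCorankZeroSurj_nonCM`, the crux `KolyvaginDepthSupply` is
  equivalent to KatoTransfer's X1 `ShaCorankZeroAtOnePrime` RESTRICTED TO NON-CM CURVES (written
  literally: `∃ p ≥ 5` good ordinary with `t_p = 0`, no surjectivity): the transfer moves `t_p = 0`
  to a big-image good ordinary prime, which exists unconditionally
  (`exists_admissiblePrime_heegnerField_of_not_hasCM`). So, granted T, the two ideator lines and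
  KatoTransfer meet in one statement on non-CM curves.

References: [Kato2004] Astérisque 295, Thm. 18.4; [SteinWuthrich2013] Math. Comp. 82, Thm. 6.1 /
§8; [BurungaleEtAl2026] Thm. 1; [Kolyvagin1991MathAnn] §2 Thm. 4.
-/

set_option linter.dupNamespace false

noncomputable section

open scoped Classical

namespace Summit.BirchSwinnertonDyer.BirchSwinnertonDyer.Theorems.KolyvaginDepthDoor

open Literature.NumberTheory.EllipticCurves Literature.NumberTheory.EllipticCurves.ModularForms
  WeierstrassCurve CongruenceSubgroup
open Summit.BirchSwinnertonDyer.BirchSwinnertonDyer.Theses.KolyvaginDepthDoor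

/-! ## λ-door row ⇒ depth row -/

/-- **Agreement of the doors, one way (modulo Kato 2004 Thm. 18.4, BCGS 2026 Thm. 1, Kolyvagin
1991 Thm. 4).** `E/ℚ` globally minimal of rank `2`; `p ≥ 5` good ordinary with `ρ̄_{E,p}` onto; `f`
a newform of `E` (`IsNewformOf W f`); suppose the λ-door row `ord_{T=0} L_p(f, α_p, T) ≤ 2`
(`PowerSeries.order` of `padicLFunction f (unitRoot W p)`). Then `corank_{ℤ_p} Ш(E/ℚ)[p^∞] = 0`
(Kato's `c ≤ ord_T L_p`, `hKato`, and Kummer `c = 2 + t_p`), AND for every admissible Heegner field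
`K` (`d_K` odd, `∉ {−3, −4}`, `p ∤ d_K`, `p` split, Heegner hypothesis for `N_E`) with
`corank Sel_{p^∞}(E^{(d_K)}/ℚ) ≤ 1` there is a depth row: ONE Kolyvagin prime `ℓ`, a datum of
conductor `ℓ`, `1 ≤ M ≤ M(ℓ)` with `c_M(ℓ) ≠ 0`
(`exists_kolyvaginClass_prime_ne_zero_of_rank_two_of_shaCorank_eq_zero`, `hA`, `hF`). CONDITIONAL
on the three facts and on the λ-row; per pair `(E, p)`; BSD is not proved by it.
[cite: Kato2004, Thm 18.4] [cite: SteinWuthrich2013, Thm. 6.1]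
[cite: BurungaleEtAl2026, Thm. 1 (arXiv:2312.09301 §0.1)] [cite: Kolyvagin1991MathAnn, §2 Thm. 4] -/
theorem exists_kolyvaginClass_prime_ne_zero_of_order_padicLFunction_le_two
    (hA : BurungaleEtAl2026_exists_kolyvaginClass_ne_zero)
    (hF : Kolyvagin1991_selmerCorank_of_kolyvaginClass_ne_zero)
    (W : WeierstrassCurve ℚ) [W.IsElliptic] [W.IsGloballyMinimal] (hr : W.mordellWeilRank = 2)
    (p : ℕ) [hp : Fact p.Prime] (h5 : 5 ≤ p) (hgood : W.HasGoodReductionAtPrime p)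
    (hord : ¬ (p : ℤ) ∣ W.frobeniusTrace p) (hsurj : W.HasSurjectiveModNGaloisRep p)
    {N : ℕ} [NeZero N] (f : CuspForm (Gamma0 N) 2) (hf : IsNewformOf W f)
    (hKato : kato_selmerCorank_le_order_padicLFunction W p (f := f))
    (hlam : (padicLFunction f (unitRoot W p : ℚ_[p])).order ≤ (2 : ℕ)) :
    W.shaCorank p = 0 ∧
      ∀ (K : Type) [Field K] [NumberField K], IsImaginaryQuadratic K →
        NumberField.discr K ≠ -3 → NumberField.discr K ≠ -4 → ¬ ((p : ℤ) ∣ NumberField.discr K) →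
        ∀ [NeZero (W.conductorNorm ℤ)], SatisfiesHeegnerHypothesis (W.conductorNorm ℤ) K →
        Odd (NumberField.discr K) → SatisfiesHeegnerHypothesis p K →
        (W.quadraticTwist (NumberField.discr K : ℚ)).selmerCorank p ≤ 1 →
        ∃ (Dt : ModularParametrizationData W (W.conductorNorm ℤ)) (β : ℤ) (ι : K →+* ℂ) (ℓ : ℕ)
          (d : KolyvaginHeegnerData Dt β ι ℓ) (M : ℕ),
          ℓ.Prime ∧ Zhang2014.IsKolyvaginPrime (W.conductorNorm ℤ) W K p ℓ ∧
          1 ≤ M ∧ (M : ℕ∞) ≤ Zhang2014.levelIndex W p ℓ ∧ d.kolyvaginClass hp.out M ≠ 0 := by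
  -- Kato: `c ≤ ord_T L_p ≤ 2`; Kummer: `c = 2 + t_p`
  have hp2 : p ≠ 2 := by omega
  have hc : (W.selmerCorank p : ℕ∞) ≤ (2 : ℕ) := (hKato hp2 ⟨hgood, hord⟩ hf).trans hlam
  have hc' : W.selmerCorank p ≤ 2 := by exact_mod_cast hc
  have hid : W.selmerCorank p = W.mordellWeilRank + W.shaCorank p :=
    W.selmerCorank_eq_mordellWeilRank_add_holds p
  have ht : W.shaCorank p = 0 := by omega
  refine ⟨ht, ?_⟩
  intro K _ _ hK h3 h4 hpd _ hH hodd hps hcK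
  exact exists_kolyvaginClass_prime_ne_zero_of_rank_two_of_shaCorank_eq_zero hA hF W hr p h5 hgood
    hord hsurj K hK h3 h4 hpd hH hodd hps hcK ht

/-! ## The crux versus KatoTransfer's X1 on non-CM curves, under the cross-prime transfer T -/

/-- **Under `FiniteShaComponentTransfer` the crux is X1 on non-CM curves (modulo seven theorems in
print).** Hypotheses: `hT` = the sibling line's crux `FiniteShaComponentTransfer`
(stmt-BirchSwinnertonDyer-22356) written literally — `corank Ш(E)[p^∞] = 0 ⇒ corank Ш(E)[q^∞] = 0`
for all primes `p, q` (open; implied by finiteness of `Ш`) — and the seven named facts of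
`kolyvaginDepthSupply_iff_shaCorankZeroSurj_nonCM` (BCGS 2026, Kolyvagin 1991, modularity,
Hoffstein–Luo, Bump–Friedberg–Hoffstein, Gross–Zagier–Kolyvagin, `p`-parity). Conclusion:
`KolyvaginDepthSupply ↔` (every non-CM globally minimal `E/ℚ` has SOME `p ≥ 5` of good ordinary
reduction with `corank_{ℤ_p} Ш(E)[p^∞] = 0`) — KatoTransfer's `ShaCorankZeroAtOnePrime` restricted
to non-CM curves, with no image condition. `←`: the transfer moves `t_{p₀} = 0` to a good ordinary
`p ≥ 5` with `ρ̄_{E,p}` onto, which exists unconditionally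
(`exists_admissiblePrime_heegnerField_of_not_hasCM`: Serre + density of ordinary primes), and the
calibration applies. CONDITIONAL on `hT` (open) and the seven facts; BSD is not proved by it.
[cite: Kolyvagin1991MathAnn, §2 Thm. 4] [cite: BurungaleEtAl2026, Thm. 1 (arXiv:2312.09301 §0.1)]
[cite: DokchitserDokchitserAnnals2010, Thm. 1.4] -/
theorem kolyvaginDepthSupply_iff_shaCorankZero_nonCM_of_transfer
    (hT : ∀ (W : WeierstrassCurve ℚ) [W.IsElliptic] (p q : ℕ) [Fact p.Prime] [Fact q.Prime],
      W.shaCorank p = 0 → W.shaCorank q = 0)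
    (hA : BurungaleEtAl2026_exists_kolyvaginClass_ne_zero)
    (hF : Kolyvagin1991_selmerCorank_of_kolyvaginClass_ne_zero)
    (hmod : exists_isNewformOf) (hHL : HoffsteinLuo1997_exists_twist_L_one_ne_zero)
    (hBFH : bumpFriedbergHoffstein_exists_heegnerField_split_twist_simpleZero)
    (hGZK : rank_eq_analyticRank_of_analyticRank_le_one)
    (hDD : ∀ (W : WeierstrassCurve ℚ) [W.IsElliptic] (p : ℕ) [Fact p.Prime], p_parity W p) :
    KolyvaginDepthSupply ↔
      ∀ (W : WeierstrassCurve ℚ) [W.IsElliptic] [W.IsGloballyMinimal], ¬ W.HasCM →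
        ∃ (p : ℕ) (_ : Fact p.Prime), 5 ≤ p ∧ W.HasGoodReductionAtPrime p ∧
          ¬ (p : ℤ) ∣ W.frobeniusTrace p ∧ W.shaCorank p = 0 := by
  rw [kolyvaginDepthSupply_iff_shaCorankZeroSurj_nonCM hA hF hmod hHL hBFH hGZK hDD]
  constructor
  · intro h W _ _ hcm
    obtain ⟨p, hp, h5, hgood, hord, -, ht⟩ := h W hcm
    exact ⟨p, hp, h5, hgood, hord, ht⟩
  · intro h W _ _ hcm
    obtain ⟨p₀, hp₀, -, -, -, ht₀⟩ := h W hcm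
    obtain ⟨p, hp, h5, hgood, hord, hsurj, -⟩ := exists_admissiblePrime_heegnerField_of_not_hasCM W hcm
    exact ⟨p, hp, h5, hgood, hord, hsurj, hT W p₀ p ht₀⟩

end Summit.BirchSwinnertonDyer.BirchSwinnertonDyer.Theorems.KolyvaginDepthDoor

end
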